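import Mathlib
import Literature.Computability.AlgebraicComplexity.LandsbergRessayreNormalForm
import Literature.Computability.AlgebraicComplexity.LRPencilOfMatrix
import Literature.Computability.AlgebraicComplexity.BIPPaddingDegenerations
import Summits.ValiantsHypothesis.ValiantsHypothesis.Theorems.FreeSubtorusSubtorusCovering
import Summits.ValiantsHypothesis.ValiantsHypothesis.Theorems.FreeSubtorusConfusionCoveringGradedForm
import Summits.ValiantsHypothesis.ValiantsHypothesis.Theorems.FreeSubtorusConfusionCoveringLeibnizExtract
import Summits.ValiantsHypothesis.ValiantsHypothesis.Theorems.FreeSubtorusConfusionCoveringFlowPath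

/-!
# `ConfusionCovering` (crux dir `OrbitDimensionBound`, stmt-ValiantsHypothesis-16133, route FreeSubtorus):
# SUBTORUS PATH WEIGHTS — every permutation is served at every level (the stub `stub_pathWeights`)

This is the registered stub `stub_pathWeights` of the lines `birth` (floor `SubtorusCovering`), `confusion_covering`
(rung `ConfusionCovering`) and — with primes for the weights — `TorusBound`, proved for ARBITRARY acyclic weights,
hence for generic elements of SUBTORI (whose weights have multiplicative coincidences, so that the canonical-subspace
descent of `LandsbergRessayreThm21Proofs`, which needs injective weights, does not apply).

**Theorem (`stub_pathWeights`).**  Let `A` be a regular affine matrix (entries of degree `≤ 1`, `rank A₀ = m - 1`),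
`c : [n] × [n] → ℂˣ` weights without non-negative multiplicative relations (`∏ c^u ≠ 1` for `0 ≠ u ∈ ℕ^{n×n}`),
`(g, h) ∈ GL_m²` with `g A₀ = A₀ h`, `g A_p = c_p A_p h`, and `ker A₀ ⊆ E_h(γ₀)`, where `det A = per_n`.  Then for
every `σ ∈ 𝔖_n` and every `1 ≤ i ≤ n` some `i`-set `I` of rows has `E_g(γ₀ ∏_{k ∈ I} c_{k σ(k)}) ≠ 0`.

**Proof (graded Leibniz / flow argument, new).**  In bases adapted to the generalised eigenspaces of `h` (columns,
weights `α`) and `g` (rows, weights `β`) the matrix is graded (`exists_gradedForm`): a constant entry forces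
`β_i = α_j`, an `x_p`-coefficient forces `β_i = c_p α_j`.  Substitute the `y`-weighted permutation matrix of `σ`
(`x_{k σ(k)} = y_k`, else `0`): the determinant becomes `det P det Q · y_1 ⋯ y_n`, so (`Leibniz extraction`) one
permutation `π` and one injection `τ : [n] ↪ [m]` carry the monomial: `β_{π τ k} = c_{k σ k} α_{τ k}` and
`β_{π j} = α_j` off the range of `τ`.  Counting rows and columns of each weight, the "edges"
`α_{τ k} → β_{π τ k}` form a flow whose divergence at `w` is `dim E_g(w) - dim E_h(w)`, which is `≥ 0` off `γ₀` and
`≥ -1` at `γ₀` (regularity: `A₀` maps `E_h(w) → E_g(w)` with kernel `⊆ ker A₀ ⊆ E_h(γ₀)`, `dim ker A₀ ≤ 1`);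
acyclicity (no relations) makes the flow ONE path from `γ₀` through `γ₀ c_{k₁σk₁}`, `γ₀ c_{k₁σk₁} c_{k₂σk₂}`, …
(`exists_chain_of_flow`), whose vertices are generalised eigenvalues of `g`. [cite: LandsbergRessayre2017, §6]
-/

open Matrix MvPolynomial Finset Module.End
open Literature.Computability.AlgebraicComplexity LRPencil

-- the mandated summit-side namespace repeats a component by design (single-problem summit)
set_option linter.dupNamespace false

namespace Summit.ValiantsHypothesis.ValiantsHypothesis.Theorems.FreeSubtorusConfusionCovering

noncomputable section

/-! ### Small tools -/

/-- Conjugating by constant matrices keeps entries affine. [folklore] -/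
theorem totalDegree_C_mul_mul_C_le_one {m : ℕ} {ι : Type*} (P Q : Matrix (Fin m) (Fin m) ℂ)
    (A : Matrix (Fin m) (Fin m) (MvPolynomial ι ℂ)) (hA : ∀ i j, (A i j).totalDegree ≤ 1) (i j : Fin m) :
    ((P.map C * A * Q.map C : Matrix (Fin m) (Fin m) (MvPolynomial ι ℂ)) i j).totalDegree ≤ 1 := by
  rw [Matrix.mul_apply]
  refine totalDegree_finsetSum_le fun b _ => ?_
  rw [Matrix.mul_apply, Matrix.map_apply]
  refine (totalDegree_mul _ _).trans ?_
  rw [totalDegree_C, add_zero]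
  refine totalDegree_finsetSum_le fun a _ => ?_
  rw [Matrix.map_apply]
  refine (totalDegree_mul _ _).trans ?_
  rw [totalDegree_C, zero_add]
  exact hA a b

/-- The substitution `x_{k, σ k} ↦ y_k`, all other `x_{kl} ↦ 0` (the `y`-weighted permutation matrix of `σ`) has
affine values. [folklore] -/
theorem totalDegree_permSubst_le (n : ℕ) (σ : Equiv.Perm (Fin n)) (p : Fin n × Fin n) :
    ((fun p : Fin n × Fin n => if p.2 = σ p.1 then (X p.1 : MvPolynomial (Fin n) ℂ) else 0) p).totalDegree ≤ 1 := by
  dsimp only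
  split_ifs
  · exact (totalDegree_X _).le
  · simp

/-- `per_n` of the `y`-weighted permutation matrix of `σ` is `y_1 ⋯ y_n`. [folklore] -/
theorem aeval_permSubst_perPoly (n : ℕ) (σ : Equiv.Perm (Fin n)) :
    aeval (fun p : Fin n × Fin n => if p.2 = σ p.1 then (X p.1 : MvPolynomial (Fin n) ℂ) else 0)
      (perPoly (Fin n) ℂ) = ∏ k, X k := by
  classical
  rw [aeval_perPoly, Matrix.permanent]
  rw [Finset.sum_eq_single σ⁻¹]
  · simp only [Matrix.of_apply, Equiv.Perm.inv_def, Equiv.apply_symm_apply, if_true]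
    exact Equiv.prod_comp σ.symm (fun k => (X k : MvPolynomial (Fin n) ℂ))
  · intro τ _ hτ
    obtain ⟨i, hi⟩ : ∃ i, τ i ≠ σ⁻¹ i := by
      by_contra h; push Not at h; exact hτ (Equiv.ext h)
    apply Finset.prod_eq_zero (mem_univ i)
    simp only [Matrix.of_apply]
    rw [if_neg]
    intro h
    apply hi
    rw [Equiv.Perm.inv_def, Equiv.eq_symm_apply]
    exact h.symm
  · intro h; exact absurd (mem_univ _) h

/-- Coefficients after the substitution: for affine `q`, the constant coefficient is unchanged and the coefficient of
`y_k` is the coefficient of `x_{k, σ k}`. [folklore] -/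
theorem coeff_aeval_permSubst {n : ℕ} (σ : Equiv.Perm (Fin n)) (q : MvPolynomial (Fin n × Fin n) ℂ)
    (hq : q.totalDegree ≤ 1) :
    coeff 0 (aeval (fun p : Fin n × Fin n => if p.2 = σ p.1 then (X p.1 : MvPolynomial (Fin n) ℂ) else 0) q) =
        coeff 0 q ∧
      ∀ k, coeff (Finsupp.single k 1)
          (aeval (fun p : Fin n × Fin n => if p.2 = σ p.1 then (X p.1 : MvPolynomial (Fin n) ℂ) else 0) q) =
        coeff (Finsupp.single (k, σ k) 1) q := by
  classical
  have hexp : aeval (fun p : Fin n × Fin n => if p.2 = σ p.1 then (X p.1 : MvPolynomial (Fin n) ℂ) else 0) q =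
      C (coeff 0 q) + ∑ k, coeff (Finsupp.single (k, σ k) 1) q • X k := by
    conv_lhs => rw [eq_affine_of_totalDegree_le_one q hq]
    simp only [map_add, map_sum, map_mul, algHom_C, aeval_X, MvPolynomial.algebraMap_eq]
    congr 1
    rw [Fintype.sum_prod_type]
    refine Finset.sum_congr rfl fun k _ => ?_
    rw [Finset.sum_eq_single (σ k)]
    · rw [if_pos rfl, smul_eq_C_mul]
    · intro l _ hl; rw [if_neg hl, mul_zero]
    · intro h; exact absurd (mem_univ _) h
  rw [hexp]
  refine ⟨?_, fun k => ?_⟩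
  · simp only [coeff_add, coeff_C, if_true, coeff_sum, coeff_smul, coeff_zero_X, smul_zero, sum_const_zero,
      add_zero]
  · simp only [coeff_add, coeff_C, coeff_sum, coeff_smul, coeff_X, smul_eq_mul]
    rw [if_neg (fun h => one_ne_zero (Finsupp.single_eq_zero.1 h.symm)), zero_add]
    rw [Finset.sum_eq_single k]
    · rw [if_pos rfl, mul_one]
    · intro l _ hl
      rw [if_neg (fun h => hl (Finsupp.single_left_injective one_ne_zero h)), mul_zero]
    · intro h; exact absurd (mem_univ _) h

/-- No non-negative multiplicative relation among the `c_p` implies: no product of a non-empty SEQUENCE of the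
weights `c_{k, σ k}` is `1`. [folklore] -/
theorem prod_seq_ne_one {n : ℕ} (c : Fin n × Fin n → ℂ)
    (hrel : ∀ u : Fin n × Fin n → ℕ, u ≠ 0 → (∏ p, (c p) ^ (u p)) ≠ 1) (σ : Equiv.Perm (Fin n))
    (t : ℕ) (p : ℕ → Fin n) (ht : 0 < t) : ∏ s ∈ range t, c (p s, σ (p s)) ≠ 1 := by
  classical
  set gr : ℕ → Fin n × Fin n := fun s => (p s, σ (p s)) with hgr
  set u : Fin n × Fin n → ℕ := fun q => ((range t).filter fun s => gr s = q).card with hu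
  have hprod : ∏ q, (c q) ^ (u q) = ∏ s ∈ range t, c (p s, σ (p s)) := by
    have h1 : ∏ s ∈ range t, c (p s, σ (p s)) = ∏ s ∈ range t, c (gr s) := rfl
    rw [h1, Finset.prod_comp c gr]
    symm
    refine Finset.prod_subset (subset_univ _) fun q _ hq => ?_
    have : u q = 0 := by
      rw [hu]
      simp only [card_eq_zero, filter_eq_empty_iff]
      intro s hs hq'
      exact hq (mem_image.2 ⟨s, hs, hq'⟩)
    change c q ^ u q = 1
    rw [this, pow_zero]
  have hu0 : u ≠ 0 := by
    intro h
    have h1 : u (gr 0) = 0 := by rw [h]; rfl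
    rw [hu] at h1
    simp only [card_eq_zero, filter_eq_empty_iff] at h1
    exact h1 (mem_range.2 ht) rfl
  rw [← hprod]
  exact hrel u hu0

/-- Counting through a permutation and an embedding: for a predicate on `Fin m`,
`#{j | P (π j)} = #{i | P i}` and `#{j | P j} = #{v | P (τ v)} + #{j ∉ range τ | P j}`. [folklore] -/
theorem card_filter_perm {m : ℕ} (π : Equiv.Perm (Fin m)) (P : Fin m → Prop) [DecidablePred P] :
    (univ.filter fun j => P (π j)).card = (univ.filter P).card := by
  classical
  have : (univ.filter fun j => P (π j)).map π.toEmbedding = univ.filter P := by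
    ext i
    simp only [mem_map_equiv, mem_filter, mem_univ, true_and, Equiv.apply_symm_apply]
  rw [← this, card_map]

/-- Splitting a count along the range of an embedding. [folklore] -/
theorem card_filter_split {m : ℕ} {ι : Type*} [Fintype ι] (τ : ι ↪ Fin m) (P : Fin m → Prop) [DecidablePred P] :
    (univ.filter P).card =
      (univ.filter fun v => P (τ v)).card + (univ.filter fun j => P j ∧ j ∉ Set.range τ).card := by
  classical
  rw [← Finset.card_filter_add_card_filter_not (s := univ.filter P) (fun j => j ∈ Set.range τ)]
  congr 1
  · have : (univ.filter P).filter (fun j => j ∈ Set.range τ) = (univ.filter fun v => P (τ v)).map τ := by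
      ext j
      simp only [mem_filter, mem_univ, true_and, mem_map, Set.mem_range]
      constructor
      · rintro ⟨hP, v, rfl⟩; exact ⟨v, hP, rfl⟩
      · rintro ⟨v, hP, rfl⟩; exact ⟨hP, v, rfl⟩
    rw [this, card_map]
  · congr 1; ext j; simp only [mem_filter, mem_univ, true_and]

/-! ### The theorem -/

/-- **Subtorus path weights (registered stub `stub_pathWeights` of the lines `birth` / `confusion_covering`;
`TorusBound`'s stub with primes replaced by acyclic weights).**  For a regular affine determinantal representation `A`
of `per_n`, weights `c` without non-negative multiplicative relations, an exact lift `(g, h)` with `g A₀ = A₀ h`,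
`g A_p = c_p A_p h` and `ker A₀ ⊆ E_h(γ₀)`: every `σ ∈ 𝔖_n` is served at every level `1 ≤ i ≤ n` by a generalised
eigenvalue `γ₀ ∏_{k ∈ I} c_{k σ(k)}` of `g`, `|I| = i`.  Proof: graded Leibniz / flow argument (module docstring).
[cite: LandsbergRessayre2017, §6] -/
theorem stub_pathWeights :
    ∀ (n m : ℕ) (A : Matrix (Fin m) (Fin m) (MvPolynomial (Fin n × Fin n) ℂ)) (c : Fin n × Fin n → ℂ)
    (g h : GL (Fin m) ℂ) (γ₀ : ℂ),
    (∀ p, c p ≠ 0) →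
    (∀ u : Fin n × Fin n → ℕ, u ≠ 0 → (∏ p, (c p) ^ (u p)) ≠ 1) →
    IsRegularDetRepr (perPoly (Fin n) ℂ) A →
    (g : Matrix (Fin m) (Fin m) ℂ) * constPart A = constPart A * (h : Matrix (Fin m) (Fin m) ℂ) →
    (∀ p : Fin n × Fin n, (g : Matrix (Fin m) (Fin m) ℂ) * coeffMat A p =
        c p • (coeffMat A p * (h : Matrix (Fin m) (Fin m) ℂ))) →
    LinearMap.ker (Matrix.toLin' (constPart A)) ≤
      Module.End.maxGenEigenspace (Matrix.toLin' (h : Matrix (Fin m) (Fin m) ℂ)) γ₀ →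
    ∀ (σ : Equiv.Perm (Fin n)) (i : ℕ), 1 ≤ i → i ≤ n →
      ∃ I : Finset (Fin n), I.card = i ∧
        Module.End.maxGenEigenspace (Matrix.toLin' (g : Matrix (Fin m) (Fin m) ℂ))
          (γ₀ * ∏ k ∈ I, c (k, σ k)) ≠ ⊥ := by
  intro n m A c g h γ₀ hc0 hrel hreg hgΛ hgA hker σ i hi1 hin
  classical
  set G := Matrix.toLin' (g : Matrix (Fin m) (Fin m) ℂ) with hG
  set H := Matrix.toLin' (h : Matrix (Fin m) (Fin m) ℂ) with hH
  have haff : ∀ i j, (A i j).totalDegree ≤ 1 := hreg.1.1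
  have hdet : A.det = perPoly (Fin n) ℂ := hreg.1.2
  -- (1) graded form
  obtain ⟨P, Q, α, β, hconst, hcoef, hβ, hα⟩ := exists_gradedForm A c (g : Matrix (Fin m) (Fin m) ℂ) h hgΛ hgA
  set A' := (P : Matrix (Fin m) (Fin m) ℂ).map C * A * (Q : Matrix (Fin m) (Fin m) ℂ).map C with hA'
  have haff' : ∀ i j, (A' i j).totalDegree ≤ 1 := totalDegree_C_mul_mul_C_le_one _ _ A haff
  -- (2) substitute the `y`-weighted permutation matrix of `σ`
  set M : Matrix (Fin m) (Fin m) (MvPolynomial (Fin n) ℂ) :=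
    A'.map (aeval fun p : Fin n × Fin n => if p.2 = σ p.1 then (X p.1 : MvPolynomial (Fin n) ℂ) else 0) with hM
  have hMaff : ∀ i j, (M i j).totalDegree ≤ 1 := fun i j =>
    FreeSubtorusSubtorusCovering.totalDegree_aeval_le_one _ (totalDegree_permSubst_le n σ) _ (haff' i j)
  have hMdet : M.det = C ((P : Matrix (Fin m) (Fin m) ℂ).det * (Q : Matrix (Fin m) (Fin m) ℂ).det) * ∏ k, X k := by
    rw [hM, ← AlgHom.mapMatrix_apply, ← AlgHom.map_det, hA', Matrix.det_mul, Matrix.det_mul,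
      ← RingHom.mapMatrix_apply, ← RingHom.mapMatrix_apply, ← RingHom.map_det, ← RingHom.map_det, hdet,
      map_mul, map_mul, aeval_permSubst_perPoly, algHom_C, algHom_C, MvPolynomial.algebraMap_eq, map_mul]
    ring
  have hMcoeff : coeff (∑ v : Fin n, Finsupp.single v 1) M.det ≠ 0 := by
    have hX : (∏ k : Fin n, (X k : MvPolynomial (Fin n) ℂ)) = monomial (∑ k : Fin n, Finsupp.single k 1) 1 := by
      rw [monomial_sum_one]; rfl
    rw [hMdet, hX, C_mul_monomial, mul_one, coeff_monomial, if_pos rfl]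
    exact mul_ne_zero (Matrix.GeneralLinearGroup.det_ne_zero P) (Matrix.GeneralLinearGroup.det_ne_zero Q)
  -- (3) Leibniz extraction
  obtain ⟨π, τ, hvar, hcon⟩ := exists_perm_embedding_of_coeff_det_ne_zero M hMaff hMcoeff
  have hedge : ∀ v, β (π (τ v)) = c (v, σ v) * α (τ v) := by
    intro v
    apply hcoef (v, σ v)
    have h1 := hvar v
    rw [hM, Matrix.map_apply, (coeff_aeval_permSubst σ _ (haff' _ _)).2] at h1
    rwa [coeffMat_apply]
  have hoff : ∀ j, j ∉ Set.range τ → β (π j) = α j := by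
    intro j hj
    apply hconst
    have h1 := hcon j hj
    rw [hM, Matrix.map_apply, (coeff_aeval_permSubst σ _ (haff' _ _)).1] at h1
    rwa [constPart_apply, constantCoeff_eq]
  -- (4) the edges `α (τ v) → β (π (τ v))` with multipliers `c (v, σ v)`
  set src : Fin n → ℂ := fun v => α (τ v) with hsrc_def
  set dst : Fin n → ℂ := fun v => β (π (τ v)) with hdst_def
  set c' : Fin n → ℂ := fun v => c (v, σ v) with hc'_def
  have hdst' : ∀ v ∈ (univ : Finset (Fin n)), dst v = c' v * src v := fun v _ => hedge v
  have hHinj : Function.Injective H := by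
    intro x y hxy
    rw [hH, Matrix.toLin'_apply, Matrix.toLin'_apply] at hxy
    exact (Matrix.mulVec_injective_iff_isUnit.2 (Units.isUnit h)) hxy
  have hαne : ∀ j, α j ≠ 0 := by
    intro j h0
    have h1 : 1 ≤ (univ.filter fun j' => α j' = α j).card :=
      Finset.one_le_card.2 ⟨j, mem_filter.2 ⟨mem_univ _, rfl⟩⟩
    rw [hα, h0, ← hH, maxGenEigenspace_zero_eq_bot_of_injective H hHinj, finrank_bot] at h1
    exact Nat.not_succ_le_zero 0 h1
  have hsrc' : ∀ v ∈ (univ : Finset (Fin n)), src v ≠ 0 := fun v _ => hαne (τ v)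
  have hc'0 : ∀ v ∈ (univ : Finset (Fin n)), c' v ≠ 0 := fun v _ => hc0 _
  -- (5) counting rows and columns of each weight
  have hrow : ∀ w, Module.finrank ℂ (Module.End.maxGenEigenspace G w) =
      (univ.filter fun v => dst v = w).card + (univ.filter fun j => α j = w ∧ j ∉ Set.range τ).card := by
    intro w
    rw [hG, ← hβ w, ← card_filter_perm π (fun i => β i = w), card_filter_split τ (fun j => β (π j) = w)]
    congr 1
    refine congrArg Finset.card (Finset.filter_congr fun j _ => ?_)
    constructor
    · rintro ⟨h1, h2⟩; exact ⟨(hoff j h2) ▸ h1, h2⟩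
    · rintro ⟨h1, h2⟩; exact ⟨(hoff j h2).symm ▸ h1, h2⟩
  have hcol : ∀ w, Module.finrank ℂ (Module.End.maxGenEigenspace H w) =
      (univ.filter fun v => src v = w).card + (univ.filter fun j => α j = w ∧ j ∉ Set.range τ).card := by
    intro w
    rw [hH, ← hα w, card_filter_split τ (fun j => α j = w)]
  have hint : G ∘ₗ Matrix.toLin' (constPart A) = Matrix.toLin' (constPart A) ∘ₗ H := by
    rw [hG, hH, ← Matrix.toLin'_mul, hgΛ, Matrix.toLin'_mul]
  have hflowA : ∀ w, w ≠ γ₀ →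
      ((univ : Finset (Fin n)).filter fun v => src v = w).card ≤ (univ.filter fun v => dst v = w).card := by
    intro w hw
    have h1 := finrank_maxGen_le_of_ker_le G H (Matrix.toLin' (constPart A)) hint hker hw
    rw [hrow w, hcol w] at h1
    omega
  have hK : Module.finrank ℂ (LinearMap.ker (Matrix.toLin' (constPart A))) ≤ 1 := by
    have h1 := LinearMap.finrank_range_add_finrank_ker (Matrix.toLin' (constPart A))
    rw [Module.finrank_fin_fun] at h1
    have h2 : Module.finrank ℂ (LinearMap.range (Matrix.toLin' (constPart A))) = m - 1 := by
      rw [Matrix.toLin'_apply']; exact hreg.2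
    omega
  have hflowA' : ((univ : Finset (Fin n)).filter fun v => src v = γ₀).card ≤
      (univ.filter fun v => dst v = γ₀).card + 1 := by
    have h1 := finrank_maxGen_le_add G H (Matrix.toLin' (constPart A)) hint γ₀
    rw [hrow γ₀, hcol γ₀] at h1
    omega
  -- (6) the flow is one path from `γ₀`
  have hseq : ∀ (t : ℕ) (p : ℕ → Fin n), 0 < t → ∏ s ∈ range t, c' (p s) ≠ 1 :=
    fun t p ht => prod_seq_ne_one c hrel σ t p ht
  obtain ⟨I, -, hIcard, k, -, hk⟩ := exists_chain_of_flow c' src dst hseq n univ γ₀ (by simp) hc'0 hdst' hsrc'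
    hflowA hflowA' i hi1 hin
  refine ⟨I, hIcard, ?_⟩
  -- (7) the end of the `i`-th edge is a generalised eigenvalue of `g`
  have h1 : 1 ≤ (univ.filter fun i' => β i' = dst k).card :=
    Finset.one_le_card.2 ⟨π (τ k), mem_filter.2 ⟨mem_univ _, rfl⟩⟩
  rw [hβ, hk] at h1
  intro hbot
  rw [hbot, finrank_bot] at h1
  exact Nat.not_succ_le_zero 0 h1

end

end Summit.ValiantsHypothesis.ValiantsHypothesis.Theorems.FreeSubtorusConfusionCovering
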